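import Summits.AtomisticToContinuum.BoseEinsteinCondensation.Theses.BECConjugateDomination
import HarnessLib

/-!
# The smooth class of `PuffFloor` is inhabited by interacting potentials, with AND without a core
(negative-side lemma for crux `PuffFloor`, stmt-AtomisticToContinuum-11785; cycle 3)

Cycle-3 file of the refuter's negative-side chain for crux `PuffFloor` of route
`BECConjugateDomination` (cdisprove seat gen 3, 2026-08-16). NON-VACUITY of the crux's interface
(the "smooth class": `IsRepulsiveFiniteRange v`, `∀ r, v r ≠ ⊤`, `ContDiff ℝ 2 ṽ`,
edge condition `‖D²ṽ‖ ≤ Cₑ √ṽ`, `ṽ(x) = (v ‖x‖).toReal`), on both branches of the picked line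
`coupling-slope-pocket` (`PuffFloor_of` splits on `0 < v 0`):

* `norm_iteratedFDeriv_expNegInvGlue_le` — the flat glue `g(t) = e^{-1/t}` (`t > 0`), `0` (`t ≤ 0`)
  satisfies `|g|, |g'|, |g''| ≤ 480 √g` on all of `ℝ` (closed forms `g' = t⁻² g`,
  `g'' = (t⁻⁴ - 2t⁻³) g` from Mathlib's `hasDerivAt_polynomial_eval_inv_mul`, and `uⁿe^{-u} ≤ n!`);
* `exists_edgeConst_expNegInvGlue_comp` — hence for EVERY `C²` function `f : ℝ³ → ℝ` that is
  `≤ 0` off a ball, `ṽ = g ∘ f` satisfies the edge condition `‖D²ṽ‖ ≤ Cₑ √ṽ` (Faà di Bruno bound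
  `norm_iteratedFDeriv_comp_le` with the point-dependent constant `480 √g(f x)`, and compactness of
  the ball for the inner derivatives);
* `solidBump_mem_smoothClass` — `v(r) = g(R₀² - r²)` is a smooth-class member with a POSITIVE soft
  core `0 < v 0` and `v ≠ 0`: the main branch of the line (S1 + S2, Lee's close-pair domination) is
  about a non-empty, genuinely interacting family, so the crux is NOT settled by the free-gas model
  `puffFloor_holds_at_freeGas`;
* `hollowShell_mem_smoothClass` — `v(r) = g((r² - r₁²)(R₀² - r²))` (`0 < r₁ < R₀`) is a smooth-class
  member with `v 0 = 0`, vanishing on the whole ball `r ≤ r₁`, yet `v ≠ 0`: the scope-residual stub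
  `stub_corelessPairMoment` (S5 of `Lines/coupling-slope-pocket.lean`, shared with
  `sacrificial-edge-layer`) quantifies over a family that is NOT reduced to `v ≡ 0`, so it cannot be
  discharged by `FreeGasModel`, and the planner's recommended restatement `0 < v 0` removes a
  non-empty family of admissible interactions (particles closer than `r₁` do not interact: the
  comparison Hamiltonians of S1/S2 are void there, see the card §(iii)).

No Theses statement is asserted positively. All `[folklore]`.
-/

noncomputable section

namespace Summit.AtomisticToContinuum.BoseEinsteinCondensation.Theorems.PuffFloor.Negative

open Literature.MathematicalPhysics.QuantumManyBody.BoseGas MeasureTheory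
open scoped ENNReal NNReal Polynomial

/-! ### The flat glue `g = expNegInvGlue`: closed forms of `g'`, `g''` and the bound `≤ 480 √g` -/

/-- `g' = t⁻² g` on all of `ℝ` (both sides vanish for `t ≤ 0`). [folklore] -/
theorem deriv_expNegInvGlue :
    deriv expNegInvGlue = fun t => t⁻¹ ^ 2 * expNegInvGlue t := by
  funext t
  have h := expNegInvGlue.hasDerivAt_polynomial_eval_inv_mul (1 : ℝ[X]) t
  simp only [Polynomial.eval_one, one_mul, Polynomial.derivative_one, sub_zero, mul_one,
    Polynomial.eval_pow, Polynomial.eval_X] at h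
  exact h.deriv

/-- `g'' = (t⁻⁴ - 2 t⁻³) g` on all of `ℝ`. [folklore] -/
theorem deriv_deriv_expNegInvGlue :
    deriv (fun t => t⁻¹ ^ 2 * expNegInvGlue t) = fun t => (t⁻¹ ^ 4 - 2 * t⁻¹ ^ 3) * expNegInvGlue t := by
  funext t
  have h := expNegInvGlue.hasDerivAt_polynomial_eval_inv_mul (Polynomial.X ^ 2 : ℝ[X]) t
  simp only [Polynomial.eval_pow, Polynomial.eval_X] at h
  rw [h.deriv]
  simp only [Polynomial.derivative_X_pow, Polynomial.eval_mul, Polynomial.eval_pow,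
    Polynomial.eval_X, Polynomial.eval_sub, Polynomial.eval_C, Nat.cast_ofNat]
  ring

/-- `iteratedDeriv 2 g = (t⁻⁴ - 2 t⁻³) g`. [folklore] -/
theorem iteratedDeriv_two_expNegInvGlue :
    iteratedDeriv 2 expNegInvGlue = fun t => (t⁻¹ ^ 4 - 2 * t⁻¹ ^ 3) * expNegInvGlue t := by
  rw [show (2 : ℕ) = 1 + 1 from rfl, iteratedDeriv_succ, iteratedDeriv_one, deriv_expNegInvGlue,
    deriv_deriv_expNegInvGlue]

/-- For `t > 0`: `g t = s²` with `s = e^{-u}`, `u = t⁻¹/2 > 0`, and `√(g t) = s`. [folklore] -/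
theorem expNegInvGlue_eq_sq {t : ℝ} (ht : 0 < t) :
    expNegInvGlue t = Real.exp (-(t⁻¹ / 2)) ^ 2 := by
  rw [expNegInvGlue, if_neg (not_le.2 ht), sq, ← Real.exp_add]
  congr 1; ring

/-- `√(g t) = e^{-u}`, `u = t⁻¹/2`, for `t > 0`. [folklore] -/
theorem sqrt_expNegInvGlue {t : ℝ} (ht : 0 < t) :
    Real.sqrt (expNegInvGlue t) = Real.exp (-(t⁻¹ / 2)) := by
  rw [expNegInvGlue_eq_sq ht, Real.sqrt_sq (Real.exp_pos _).le]

/-- `uⁿ e^{-u} ≤ n!` for `u ≥ 0`. [folklore] -/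
theorem pow_mul_exp_neg_le_factorial {u : ℝ} (hu : 0 ≤ u) (n : ℕ) :
    u ^ n * Real.exp (-u) ≤ n.factorial := by
  have h := Real.pow_div_factorial_le_exp u hu n
  have hf : (0 : ℝ) < n.factorial := by exact_mod_cast Nat.factorial_pos n
  rw [div_le_iff₀ hf] at h
  rw [Real.exp_neg, ← div_eq_mul_inv, div_le_iff₀ (Real.exp_pos u)]
  linarith [mul_comm (Real.exp u) (n.factorial : ℝ)]

/-- `g ≤ √g` (since `0 ≤ g ≤ 1`). [folklore] -/
theorem expNegInvGlue_le_sqrt (t : ℝ) : expNegInvGlue t ≤ Real.sqrt (expNegInvGlue t) := by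
  rcases le_or_gt t 0 with ht | ht
  · simp [expNegInvGlue.zero_of_nonpos ht]
  · rw [sqrt_expNegInvGlue ht, expNegInvGlue_eq_sq ht, sq]
    refine mul_le_of_le_one_left (Real.exp_pos _).le ?_
    rw [Real.exp_le_one_iff]
    have : 0 < t⁻¹ := inv_pos.2 ht
    linarith

/-- `|g'| = t⁻² g ≤ 8 √g`. [folklore] -/
theorem abs_deriv_expNegInvGlue_le (t : ℝ) :
    |t⁻¹ ^ 2 * expNegInvGlue t| ≤ 8 * Real.sqrt (expNegInvGlue t) := by
  rcases le_or_gt t 0 with ht | ht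
  · simp [expNegInvGlue.zero_of_nonpos ht]
  · set u : ℝ := t⁻¹ / 2 with hu
    have hu0 : 0 ≤ u := by positivity
    have ht' : t⁻¹ = 2 * u := by rw [hu]; ring
    rw [sqrt_expNegInvGlue ht, expNegInvGlue_eq_sq ht, ← hu, ht', abs_of_nonneg (by positivity)]
    have h2 := pow_mul_exp_neg_le_factorial hu0 2
    simp only [Nat.factorial, Nat.succ_eq_add_one, Nat.reduceAdd, Nat.reduceMul, Nat.cast_ofNat] at h2
    have hs : 0 < Real.exp (-u) := Real.exp_pos _
    nlinarith [hs, h2]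

/-- `|g''| = |t⁻⁴ - 2t⁻³| g ≤ 480 √g`. [folklore] -/
theorem abs_deriv_deriv_expNegInvGlue_le (t : ℝ) :
    |(t⁻¹ ^ 4 - 2 * t⁻¹ ^ 3) * expNegInvGlue t| ≤ 480 * Real.sqrt (expNegInvGlue t) := by
  rcases le_or_gt t 0 with ht | ht
  · simp [expNegInvGlue.zero_of_nonpos ht]
  · set u : ℝ := t⁻¹ / 2 with hu
    have hu0 : 0 ≤ u := by positivity
    have ht' : t⁻¹ = 2 * u := by rw [hu]; ring
    rw [sqrt_expNegInvGlue ht, expNegInvGlue_eq_sq ht, ← hu, ht']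
    have h3 := pow_mul_exp_neg_le_factorial hu0 3
    have h4 := pow_mul_exp_neg_le_factorial hu0 4
    simp only [Nat.factorial, Nat.succ_eq_add_one, Nat.reduceAdd, Nat.reduceMul, Nat.cast_ofNat,
      mul_one] at h3 h4
    have hs : 0 < Real.exp (-u) := Real.exp_pos _
    rw [abs_mul, abs_of_nonneg (sq_nonneg (Real.exp (-u)))]
    have habs : |(2 * u) ^ 4 - 2 * (2 * u) ^ 3| ≤ 16 * u ^ 4 + 16 * u ^ 3 := by
      rw [abs_le]; constructor <;> nlinarith [pow_nonneg hu0 3, pow_nonneg hu0 4]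
    calc |(2 * u) ^ 4 - 2 * (2 * u) ^ 3| * Real.exp (-u) ^ 2
        ≤ (16 * u ^ 4 + 16 * u ^ 3) * Real.exp (-u) ^ 2 :=
          mul_le_mul_of_nonneg_right habs (sq_nonneg _)
      _ = 16 * (u ^ 4 * Real.exp (-u)) * Real.exp (-u) + 16 * (u ^ 3 * Real.exp (-u)) * Real.exp (-u) := by
          ring
      _ ≤ 16 * 24 * Real.exp (-u) + 16 * 6 * Real.exp (-u) := by
          gcongr
      _ = 480 * Real.exp (-u) := by ring

/-- **The flat glue has all derivatives of order `≤ 2` bounded by `480 √g`** — the one-dimensional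
content of the edge condition `‖D²ṽ‖ ≤ Cₑ √ṽ` (zeros of infinite order are admissible edges).
[folklore] -/
theorem norm_iteratedFDeriv_expNegInvGlue_le {i : ℕ} (hi : i ≤ 2) (t : ℝ) :
    ‖iteratedFDeriv ℝ i expNegInvGlue t‖ ≤ 480 * Real.sqrt (expNegInvGlue t) := by
  rw [norm_iteratedFDeriv_eq_norm_iteratedDeriv, Real.norm_eq_abs]
  have hsq : 0 ≤ Real.sqrt (expNegInvGlue t) := Real.sqrt_nonneg _
  interval_cases i
  · rw [iteratedDeriv_zero, abs_of_nonneg (expNegInvGlue.nonneg t)]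
    linarith [expNegInvGlue_le_sqrt t]
  · rw [iteratedDeriv_one, deriv_expNegInvGlue]
    linarith [abs_deriv_expNegInvGlue_le t]
  · rw [iteratedDeriv_two_expNegInvGlue]
    exact abs_deriv_deriv_expNegInvGlue_le t

/-! ### The edge condition for `g ∘ f`, `f` any `C²` function non-positive off a ball -/

/-- **Edge condition for glued profiles.** If `f : ℝ³ → ℝ` is `C²` and `f ≤ 0` outside the ball of
radius `R`, then `ṽ = g ∘ f` (`g = expNegInvGlue`) satisfies `‖D²ṽ(x)‖ ≤ Cₑ √ṽ(x)` for all `x`, for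
some `Cₑ` (`= 960 B²`, `B` a bound for `max(1, ‖Df‖, ‖D²f‖)` on the closed ball). [folklore] -/
theorem exists_edgeConst_expNegInvGlue_comp {f : Space → ℝ} (hf : ContDiff ℝ 2 f) {R : ℝ}
    (hR : ∀ x : Space, R < ‖x‖ → f x ≤ 0) :
    ∃ Cₑ : ℝ, ∀ x : Space,
      ‖iteratedFDeriv ℝ 2 (fun x => expNegInvGlue (f x)) x‖ ≤ Cₑ * Real.sqrt (expNegInvGlue (f x)) := by
  set D : Space → ℝ := fun x => max 1 (max ‖iteratedFDeriv ℝ 1 f x‖ ‖iteratedFDeriv ℝ 2 f x‖) with hD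
  have h1 : Continuous fun x => iteratedFDeriv ℝ 1 f x :=
    hf.continuous_iteratedFDeriv (by exact_mod_cast (by norm_num : (1 : ℕ) ≤ 2))
  have h2 : Continuous fun x => iteratedFDeriv ℝ 2 f x :=
    hf.continuous_iteratedFDeriv (by exact_mod_cast (le_refl 2))
  have hDcont : Continuous D := continuous_const.max (h1.norm.max h2.norm)
  obtain ⟨B, hB⟩ := (isCompact_closedBall (0 : Space) R).exists_bound_of_continuousOn hDcont.continuousOn
  have hg : ContDiff ℝ 2 expNegInvGlue := expNegInvGlue.contDiff (n := 2)
  refine ⟨2 * 480 * B ^ 2, fun x => ?_⟩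
  have hD1 : 1 ≤ D x := le_max_left _ _
  have hcomp := norm_iteratedFDeriv_comp_le (g := expNegInvGlue) (f := f) (n := 2) hg hf le_rfl x
    (C := 480 * Real.sqrt (expNegInvGlue (f x))) (D := D x)
    (fun i hi => norm_iteratedFDeriv_expNegInvGlue_le hi (f x))
    (fun i hi1 hi2 => by
      interval_cases i
      · rw [pow_one]; exact (le_max_left _ _).trans (le_max_right _ _)
      · exact ((le_max_right _ _).trans (le_max_right _ _)).trans (le_self_pow₀ hD1 two_ne_zero))
  have hfun : (expNegInvGlue ∘ f) = fun x => expNegInvGlue (f x) := rfl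
  rw [hfun] at hcomp
  refine hcomp.trans ?_
  have hsq : 0 ≤ Real.sqrt (expNegInvGlue (f x)) := Real.sqrt_nonneg _
  rcases le_or_gt ‖x‖ R with hx | hx
  · have hxB : D x ≤ B := by
      have := hB x (by simpa using hx)
      rw [Real.norm_eq_abs, abs_of_nonneg (zero_le_one.trans hD1)] at this
      exact this
    have hB0 : 0 ≤ B := (zero_le_one.trans hD1).trans hxB
    have : D x ^ 2 ≤ B ^ 2 := pow_le_pow_left₀ (zero_le_one.trans hD1) hxB 2
    calc ((2 : ℕ).factorial : ℝ) * (480 * Real.sqrt (expNegInvGlue (f x))) * D x ^ 2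
        = (2 * 480 * D x ^ 2) * Real.sqrt (expNegInvGlue (f x)) := by
          simp [Nat.factorial]; ring
      _ ≤ (2 * 480 * B ^ 2) * Real.sqrt (expNegInvGlue (f x)) := by gcongr
  · have h0 : expNegInvGlue (f x) = 0 := expNegInvGlue.zero_of_nonpos (hR x hx)
    simp [h0]

/-! ### Radial glued profiles are smooth-class members -/

/-- The radial profile `v_P(r) = g(P(r²))` of a `C²` "shape function" `P : ℝ → ℝ`. [folklore] -/
def glueProfile (P : ℝ → ℝ) : ℝ → ℝ≥0∞ := fun r => ENNReal.ofReal (expNegInvGlue (P (r ^ 2)))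

/-- `ṽ_P(x) = g(P(|x|²))`. [folklore] -/
theorem glueProfile_toReal (P : ℝ → ℝ) (x : Space) :
    (glueProfile P ‖x‖).toReal = expNegInvGlue (P (‖x‖ ^ 2)) :=
  ENNReal.toReal_ofReal (expNegInvGlue.nonneg _)

/-- `ṽ_P = g ∘ (P(|·|²))` as functions. [folklore] -/
theorem glueProfile_toReal_funext (P : ℝ → ℝ) :
    (fun x : Space => (glueProfile P ‖x‖).toReal) = fun x : Space => expNegInvGlue (P (‖x‖ ^ 2)) :=
  funext (glueProfile_toReal P)

/-- **Glued radial profiles lie in the smooth class of `PuffFloor`.** For a `C²` shape function `P`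
with `P(r²) ≤ 0` for `r > R`, `v = g(P(r²))` is repulsive of finite range,
finite, `C²` as `x ↦ v(|x|)`, and satisfies the edge condition. [folklore] -/
theorem glueProfile_mem_smoothClass {P : ℝ → ℝ} (hP : ContDiff ℝ 2 P) {R : ℝ}
    (hR : ∀ r, R < r → P (r ^ 2) ≤ 0) :
    IsRepulsiveFiniteRange (glueProfile P) ∧ (∀ r, glueProfile P r ≠ ⊤) ∧
      ContDiff ℝ 2 (fun x : Space => (glueProfile P ‖x‖).toReal) ∧
      ∃ Cₑ : ℝ, ∀ x : Space, ‖iteratedFDeriv ℝ 2 (fun x : Space => (glueProfile P ‖x‖).toReal) x‖ ≤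
        Cₑ * Real.sqrt ((glueProfile P ‖x‖).toReal) := by
  have hf : ContDiff ℝ 2 (fun x : Space => P (‖x‖ ^ 2)) := hP.comp (contDiff_norm_sq ℝ)
  refine ⟨⟨?_, R, fun r hr => ?_⟩, fun r => ENNReal.ofReal_ne_top, ?_, ?_⟩
  · -- measurable: continuous
    refine Continuous.measurable ?_
    exact ENNReal.continuous_ofReal.comp
      (expNegInvGlue.contDiff (n := 0)).continuous |>.comp (hP.continuous.comp (continuous_pow 2))
  · simp [glueProfile, expNegInvGlue.zero_of_nonpos (hR r hr)]
  · rw [glueProfile_toReal_funext]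
    exact (expNegInvGlue.contDiff (n := 2)).comp hf
  · obtain ⟨Cₑ, hC⟩ := exists_edgeConst_expNegInvGlue_comp hf (R := R) (fun x hx => hR ‖x‖ hx)
    refine ⟨Cₑ, fun x => ?_⟩
    rw [glueProfile_toReal_funext, glueProfile_toReal]
    exact hC x

/-! ### Instance 1: the solid bump `v(r) = g(R₀² - r²)` — positive soft core -/

/-- The solid soft-core bump of range `R₀`: `v(r) = e^{-1/(R₀² - r²)}` for `r < R₀`, `0` beyond.
[folklore] -/
def solidBump (R₀ : ℝ) : ℝ → ℝ≥0∞ := glueProfile fun s => R₀ ^ 2 - s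

/-- **The smooth class contains a genuinely interacting potential with a positive soft core.**
For `R₀ > 0`, `solidBump R₀` satisfies all four class hypotheses of `PuffFloor`, has `0 < v 0`
(the main branch of `Lines/coupling-slope-pocket.lean`, stubs S1–S2) and is not the zero potential:
the crux is not settled by the free-gas model (`puffFloor_holds_at_freeGas`). [folklore] -/
theorem solidBump_mem_smoothClass {R₀ : ℝ} (hR₀ : 0 < R₀) :
    IsRepulsiveFiniteRange (solidBump R₀) ∧ (∀ r, solidBump R₀ r ≠ ⊤) ∧
      ContDiff ℝ 2 (fun x : Space => (solidBump R₀ ‖x‖).toReal) ∧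
      (∃ Cₑ : ℝ, ∀ x : Space, ‖iteratedFDeriv ℝ 2 (fun x : Space => (solidBump R₀ ‖x‖).toReal) x‖ ≤
        Cₑ * Real.sqrt ((solidBump R₀ ‖x‖).toReal)) ∧
      0 < solidBump R₀ 0 ∧ solidBump R₀ ≠ 0 := by
  have hP : ContDiff ℝ 2 (fun s : ℝ => R₀ ^ 2 - s) := contDiff_const.sub contDiff_id
  have hR : ∀ r, R₀ < r → (fun s : ℝ => R₀ ^ 2 - s) (r ^ 2) ≤ 0 := by
    intro r hr
    have : R₀ ^ 2 < r ^ 2 := by nlinarith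
    simp only; linarith
  obtain ⟨h1, h2, h3, h4⟩ := glueProfile_mem_smoothClass hP hR
  have h0 : 0 < solidBump R₀ 0 := by
    change 0 < ENNReal.ofReal (expNegInvGlue (R₀ ^ 2 - 0 ^ 2))
    rw [ENNReal.ofReal_pos]
    exact expNegInvGlue.pos_of_pos (by norm_num; positivity)
  refine ⟨h1, h2, h3, h4, h0, fun h => ?_⟩
  rw [h] at h0
  exact lt_irrefl _ h0

/-! ### Instance 2: the hollow shell `v(r) = g((r² - r₁²)(R₀² - r²))` — coreless, not zero -/

/-- The hollow soft shell supported on `r₁ ≤ r ≤ R₀`: `v(r) = g((r² - r₁²)(R₀² - r²))`; particles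
closer than `r₁` do not interact. [folklore] -/
def hollowShell (r₁ R₀ : ℝ) : ℝ → ℝ≥0∞ := glueProfile fun s => (s - r₁ ^ 2) * (R₀ ^ 2 - s)

/-- **The coreless part of the smooth class is not reduced to `v ≡ 0`.** For `0 < r₁ < R₀`,
`hollowShell r₁ R₀` satisfies all four class hypotheses of `PuffFloor`, has `v 0 = 0` — indeed
`v r = 0` for every `r ≤ r₁` — and is not the zero potential (`v((r₁+R₀)/2…) ≠ 0` at `r² =
(r₁²+R₀²)/2`). Hence the scope-residual stub `stub_corelessPairMoment` (S5 of
`Lines/coupling-slope-pocket.lean` = `Lines/sacrificial-edge-layer.lean`) is a statement about exact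
minimisers of genuinely interacting coreless potentials: it is NOT dischargeable by `FreeGasModel`,
and the recommended restatement of the class with `0 < v 0` excludes a non-empty admissible family.
[folklore] -/
theorem hollowShell_mem_smoothClass {r₁ R₀ : ℝ} (hr₁ : 0 < r₁) (hR : r₁ < R₀) :
    IsRepulsiveFiniteRange (hollowShell r₁ R₀) ∧ (∀ r, hollowShell r₁ R₀ r ≠ ⊤) ∧
      ContDiff ℝ 2 (fun x : Space => (hollowShell r₁ R₀ ‖x‖).toReal) ∧
      (∃ Cₑ : ℝ, ∀ x : Space,
        ‖iteratedFDeriv ℝ 2 (fun x : Space => (hollowShell r₁ R₀ ‖x‖).toReal) x‖ ≤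
          Cₑ * Real.sqrt ((hollowShell r₁ R₀ ‖x‖).toReal)) ∧
      (∀ r, |r| ≤ r₁ → hollowShell r₁ R₀ r = 0) ∧
      hollowShell r₁ R₀ (Real.sqrt ((r₁ ^ 2 + R₀ ^ 2) / 2)) ≠ 0 := by
  have hR₀ : 0 < R₀ := hr₁.trans hR
  have hP : ContDiff ℝ 2 (fun s : ℝ => (s - r₁ ^ 2) * (R₀ ^ 2 - s)) :=
    (contDiff_id.sub contDiff_const).mul (contDiff_const.sub contDiff_id)
  have hRr : ∀ r, R₀ < r → (fun s : ℝ => (s - r₁ ^ 2) * (R₀ ^ 2 - s)) (r ^ 2) ≤ 0 := by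
    intro r hr
    have h1 : R₀ ^ 2 < r ^ 2 := by nlinarith
    have h2 : r₁ ^ 2 < r ^ 2 := by nlinarith
    simp only
    nlinarith
  obtain ⟨h1, h2, h3, h4⟩ := glueProfile_mem_smoothClass hP hRr
  refine ⟨h1, h2, h3, h4, fun r hr => ?_, ?_⟩
  · simp only [hollowShell, glueProfile, ENNReal.ofReal_eq_zero]
    refine le_of_eq (expNegInvGlue.zero_of_nonpos ?_)
    have hr2 : r ^ 2 ≤ r₁ ^ 2 := by
      rw [← sq_abs r]; exact pow_le_pow_left₀ (abs_nonneg r) hr 2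
    have hR2 : r ^ 2 < R₀ ^ 2 := lt_of_le_of_lt hr2 (by nlinarith)
    nlinarith
  · simp only [hollowShell, glueProfile, ne_eq, ENNReal.ofReal_eq_zero, not_le]
    refine expNegInvGlue.pos_of_pos ?_
    rw [Real.sq_sqrt (by positivity)]
    have : r₁ ^ 2 < R₀ ^ 2 := by nlinarith
    nlinarith

end Summit.AtomisticToContinuum.BoseEinsteinCondensation.Theorems.PuffFloor.Negative

end
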